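import Mathlib
import Summits.NavierStokesRegularity.NavierStokesRegularity.Theorems.L3TimeExponentPincerSubparabolicFifthNode
import Summits.NavierStokesRegularity.NavierStokesRegularity.Theorems.L3TimeExponentPincerSerrinMorreyBridge
import HarnessLib.Audit
import HarnessLib

/-!
# The residual crux excludes every SUB-PARABOLIC-Morrey blow-up; the sub-parabolic Morrey pincer
# (route `L3TimeExponentPincer`, residual crux `SupercriticalSerrinL3` stmt-NavierStokesRegularity-19500, parent crux
# `L3CascadeJaw` stmt-…-19499; support file 15 of seat p4)

Support file (cell ns-regularity-ideate, seat p4, gen 5).  0 `sorry`, no definitions.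

nsreg-p2's Morrey pincer (`…SerrinMorreyBridge`, Maz'ya-free in `…JawFullMorreyHolds`):
`AllBlowupsFullMorreyB ∧ SupercriticalSerrinL3 ⇒ NavierStokesRegularity`, through
`SupercriticalSerrinL3 ⇒ NoFullMorreyTypeIBlowup` (the residual excludes scaled-energy-Type-I blow-ups).
With THEOREM J‴ and its rate form both jaws move to the bottom radii:

* `hasSmoothExtensionPast_of_subparabolicMorrey_of_supercriticalSerrinL3` — **the residual crux excludes every
  sub-parabolic-Morrey blow-up**: `SupercriticalSerrinL3` + `SubparabolicMorreyNear u T` ⇒ smooth extension past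
  `T` (J‴ gives `u ∈ L^p_t L³_x` at the residual's exponent `p < 5 < 6`).  Since Sub ⊋ Full ⊋ time-Type-I
  (`subparabolicMorreyNear_of_full`, `subparabolicMorreyNear_of_typeI`), this sharpens the certified strength of the
  residual: ⊇ {time-Type-I exclusion (p420102), full-Morrey exclusion (p433127/p435650), weak-`L³` regularity
  (p436632), **sub-parabolic-Morrey exclusion**} — `noFullMorreyTypeIBlowup_of_noSubparabolic`.
* `hasSmoothExtensionPast_of_subparabolicFifth_of_supercriticalSerrinL3` — even a GROWING sub-parabolic rate
  `∫_{B(x₀,r)}|u(t)|² ≤ M (T-t)^{-1/5} r` (`r ≤ √(T-t)`) is excluded by the residual (`β = 1/5`: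
  `p(1+β) < 6` for the residual's `p < 5`); contrapositive `not_subparabolicFifth_of_blowup_of_supercriticalSerrinL3`:
  **modulo the residual, every frame blow-up concentrates sub-parabolically FASTER than `(T-t)^{-1/5}`** at some
  late times / centres / radii `≤ √(T-t)`.
* `navierStokesRegularity_of_allBlowupsSubparabolicFifthB_of_supercriticalSerrinL3` — **the sub-parabolic pincer**:
  node `AllBlowupsSubparabolicFifthB` (support file 14) ∧ residual ⇒ Clay (A), by the route's own logic
  (node ⇒ `L3CascadeJaw`; jaw ∧ residual ⇒ no blow-up ⇒ `NoBlowupToClay`).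

WHAT THIS IS NOT: not a claim about Navier–Stokes regularity — both the node and the residual are OPEN typed
hypotheses (the residual contains Type-I exclusion, hard core 0056's shadow); no item or stub is closed.
-/

noncomputable section

namespace Summit.NavierStokesRegularity.NavierStokesRegularity.Theorems.L3TimeExponentPincerSubparabolicSerrinBridge

open MeasureTheory Set Function Filter Metric Topology
open scoped ENNReal NNReal
open Literature.Analysis.FluidPDE
open Summit.NavierStokesRegularity.NavierStokesRegularity.Theorems.L3TimeExponentPincerJawFullMorrey
  (FullMorreyTypeINear)
open Summit.NavierStokesRegularity.NavierStokesRegularity.Theorems.L3TimeExponentPincerSerrinMorreyBridge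
  (NoFullMorreyTypeIBlowup)
open Summit.NavierStokesRegularity.NavierStokesRegularity.Theorems.L3TimeExponentPincerSubparabolicMorreyJaw
  (SubparabolicMorreyNear subparabolicMorreyNear_of_full jaw_lt_six_of_subparabolicMorrey)
open Summit.NavierStokesRegularity.NavierStokesRegularity.Theorems.L3TimeExponentPincerSubparabolicMorreyRate
  (jaw_of_subparabolicMorreyPowerRate)
open Summit.NavierStokesRegularity.NavierStokesRegularity.Theorems.L3TimeExponentPincerSubparabolicFifthNode
  (AllBlowupsSubparabolicFifthB)
open Summit.NavierStokesRegularity.NavierStokesRegularity.Theses.L3TimeExponentPincer (SupercriticalSerrinL3)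

/-! ## §1  The residual excludes sub-parabolic-Morrey blow-ups -/

/-- **`SupercriticalSerrinL3` excludes every sub-parabolic-Morrey blow-up**: a classical solution on `[0,T)`,
Leray–Hopf from a rapidly decaying datum, that is sub-parabolic-Morrey near `T` extends smoothly past `T`, given
the residual crux (J‴ supplies `∫_{T₂}^T ‖u‖₃^p < ∞` at the residual's exponent `p ∈ (4,5)`). -/
theorem hasSmoothExtensionPast_of_subparabolicMorrey_of_supercriticalSerrinL3 (h : SupercriticalSerrinL3)
    {ν T : ℝ} (hν : 0 < ν) (hT : 0 < T)
    {u : ℝ → (EuclideanSpace ℝ (Fin 3)) → (EuclideanSpace ℝ (Fin 3))} {p : ℝ → (EuclideanSpace ℝ (Fin 3)) → ℝ}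
    (hcl : IsClassicalNSSolutionOn (Ico 0 T) ν 0 u p) (hLH : IsLerayHopfOn T ν 0 (u 0) u)
    (hdec : HasRapidSpatialDecay (u 0)) (hS : SubparabolicMorreyNear u T) :
    HasSmoothExtensionPast ν 0 u T := by
  obtain ⟨q, hq4, hq5, hSer⟩ := h
  obtain ⟨T₂, hT₂, hint⟩ := jaw_lt_six_of_subparabolicMorrey hν hT hcl hLH hS (q := q) (by linarith) (by linarith)
  exact hSer ν T hν hT u p hcl hLH hdec ⟨T₂, hT₂, hint⟩

/-- Hence the residual's full-Morrey exclusion (`NoFullMorreyTypeIBlowup`, nsreg-p2) is a COROLLARY of its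
sub-parabolic exclusion: any hypothesis excluding Sub-Morrey blow-ups excludes full-Morrey ones. -/
theorem noFullMorreyTypeIBlowup_of_noSubparabolic
    (h : ∀ (ν T : ℝ), 0 < ν → 0 < T →
      ∀ (u : ℝ → (EuclideanSpace ℝ (Fin 3)) → (EuclideanSpace ℝ (Fin 3))) (p : ℝ → (EuclideanSpace ℝ (Fin 3)) → ℝ),
        IsClassicalNSSolutionOn (Ico 0 T) ν 0 u p → IsLerayHopfOn T ν 0 (u 0) u → HasRapidSpatialDecay (u 0) →
        SubparabolicMorreyNear u T → HasSmoothExtensionPast ν 0 u T) :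
    NoFullMorreyTypeIBlowup :=
  fun ν T hν hT u p hcl hLH hdec hFM => h ν T hν hT u p hcl hLH hdec (subparabolicMorreyNear_of_full hFM)

/-! ## §2  Even the growing rate `(T-t)^{-1/5}` is excluded -/

/-- **The residual excludes the `(T-t)^{-1/5}` sub-parabolic rate**: a frame solution whose sub-parabolic scaled
energies satisfy `∫_{B(x₀,r)}|u(t)|² ≤ M (T-t)^{-1/5} r` (`r ≤ √(T-t)`, late `t`) extends smoothly past `T`, given
`SupercriticalSerrinL3` (rate form of J‴: `p(1 + 1/5) < 6` for the residual's `p < 5`). -/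
theorem hasSmoothExtensionPast_of_subparabolicFifth_of_supercriticalSerrinL3 (h : SupercriticalSerrinL3)
    {ν T : ℝ} (hν : 0 < ν) (hT : 0 < T)
    {u : ℝ → (EuclideanSpace ℝ (Fin 3)) → (EuclideanSpace ℝ (Fin 3))} {p : ℝ → (EuclideanSpace ℝ (Fin 3)) → ℝ}
    (hcl : IsClassicalNSSolutionOn (Ico 0 T) ν 0 u p) (hLH : IsLerayHopfOn T ν 0 (u 0) u)
    (hdec : HasRapidSpatialDecay (u 0)) {M : ℝ} (hM : 0 ≤ M)
    (hrate : ∃ T₁ < T, ∀ t ∈ Ioo T₁ T, ∀ x₀ : EuclideanSpace ℝ (Fin 3), ∀ r : ℝ, 0 < r → r ^ 2 ≤ T - t →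
      ∫⁻ x in ball x₀ r, ‖u t x‖ₑ ^ 2 ≤ ENNReal.ofReal (M * (T - t) ^ (-(1 / 5 : ℝ)) * r)) :
    HasSmoothExtensionPast ν 0 u T := by
  obtain ⟨q, hq4, hq5, hSer⟩ := h
  obtain ⟨T₂, hT₂, hint⟩ := jaw_of_subparabolicMorreyPowerRate hν hT hcl hLH hM (by norm_num : (0 : ℝ) ≤ 1 / 5)
    hrate (q := q) (by linarith) (by nlinarith)
  exact hSer ν T hν hT u p hcl hLH hdec ⟨T₂, hT₂, hint⟩

/-- **Contrapositive: modulo the residual, blow-ups concentrate sub-parabolically faster than `(T-t)^{-1/5}`.**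
Given `SupercriticalSerrinL3`, a frame blow-up admits NO bound `∫_{B(x₀,r)}|u(t)|² ≤ M (T-t)^{-1/5} r` over
all late `t`, all `x₀`, all `r ≤ √(T-t)`: for every `M ≥ 0` and every `T₁ < T` there are `t ∈ (T₁,T)`, `x₀` and
`0 < r ≤ √(T-t)` with `∫_{B(x₀,r)}|u(t)|² > M (T-t)^{-1/5} r`. -/
theorem not_subparabolicFifth_of_blowup_of_supercriticalSerrinL3 (h : SupercriticalSerrinL3)
    {ν T : ℝ} (hν : 0 < ν) (hT : 0 < T)
    {u : ℝ → (EuclideanSpace ℝ (Fin 3)) → (EuclideanSpace ℝ (Fin 3))} {p : ℝ → (EuclideanSpace ℝ (Fin 3)) → ℝ}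
    (hcl : IsClassicalNSSolutionOn (Ico 0 T) ν 0 u p) (hLH : IsLerayHopfOn T ν 0 (u 0) u)
    (hdec : HasRapidSpatialDecay (u 0)) (hnext : ¬ HasSmoothExtensionPast ν 0 u T) {M : ℝ} (hM : 0 ≤ M)
    {T₁ : ℝ} (hT₁ : T₁ < T) :
    ∃ t ∈ Ioo T₁ T, ∃ x₀ : EuclideanSpace ℝ (Fin 3), ∃ r : ℝ, 0 < r ∧ r ^ 2 ≤ T - t ∧
      ENNReal.ofReal (M * (T - t) ^ (-(1 / 5 : ℝ)) * r) < ∫⁻ x in ball x₀ r, ‖u t x‖ₑ ^ 2 := by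
  by_contra hcon
  simp only [not_exists, not_and, not_lt] at hcon
  exact hnext (hasSmoothExtensionPast_of_subparabolicFifth_of_supercriticalSerrinL3 h hν hT hcl hLH hdec hM
    ⟨T₁, hT₁, fun t ht x₀ r hr hrs => hcon t ht x₀ r hr hrs⟩)

/-! ## §3  The sub-parabolic Morrey pincer -/

/-- **The sub-parabolic Morrey pincer**: the node `AllBlowupsSubparabolicFifthB` (every frame blow-up has
sub-parabolic scaled energies `≲ (T-t)^{-1/5}`) together with the residual crux `SupercriticalSerrinL3` gives
Clay (A) — the route's assembly with the parent crux supplied BY NAME by the node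
(`l3CascadeJaw_of_allBlowupsSubparabolicFifthB`) and `NoBlowupToClay` by the tree. -/
theorem navierStokesRegularity_of_allBlowupsSubparabolicFifthB_of_supercriticalSerrinL3
    (hA : AllBlowupsSubparabolicFifthB) (h : SupercriticalSerrinL3) : NavierStokesRegularity :=
  Summit.NavierStokesRegularity.NavierStokesRegularity.Theorems.navierStokesRegularity_of_noBlowup
    fun ν T hν hT u p hcl hLH hdec => by
      by_contra hne
      obtain ⟨M, hM, hrate⟩ := hA ν T hν hT u p hcl hLH hdec hne
      exact hne (hasSmoothExtensionPast_of_subparabolicFifth_of_supercriticalSerrinL3 h hν hT hcl hLH hdec hM hrate)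

end Summit.NavierStokesRegularity.NavierStokesRegularity.Theorems.L3TimeExponentPincerSubparabolicSerrinBridge

end
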